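import Mathlib.Geometry.Manifold.SmoothEmbedding
import Mathlib.Geometry.Manifold.Instances.Real
import Literature.Geometry.Lorentzian.Hypersurface
import Literature.Geometry.Lorentzian.Volume
import HarnessLib

-- provenance: harness21/H21/H21/Prelude/Lorentz/TrappedSurface.lean @ 685ab3b (interim HEAD d8f2665); M5 mechanical rewrite
/-!
# Trapped surfaces and marginally outer trapped surfaces (trunk G08 = T-LORENTZ, item C11)

Codimension-two spacelike surfaces `f : S → M` in a time-oriented Lorentzian manifold `(M, g, τ)`
(statement gr.S18): null normal pairs `(L, L̲)`, the null second fundamental forms `χ_L`, the null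
expansions `θ_L = tr_{f^* g} χ_L`, *trapped surfaces* (Penrose 1965: both null expansions
negative), marginally (outer) trapped surfaces; and the initial-data-set version (Andersson–Mars–
Simon 2008): for a surface `f : S → X` in Riemannian data `(X, h, k)` with outward unit normal
`ν`, `θ± = tr_S k ± H`, MOTS (`θ⁺ = 0`), weakly outer trapped surfaces (`θ⁺ ≤ 0`), the hypothesis
structure `OutermostMOTS h k` of an outermost MOTS bounding an exterior region, and its area
`OutermostMOTS.surfaceArea` (for the Penrose inequality).

## Mathlib

Mathlib (at the pin) has `Manifold.IsSmoothEmbedding I J n f`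
(`Mathlib/Geometry/Manifold/SmoothEmbedding.lean`), the model `𝓡 2` on `EuclideanSpace ℝ (Fin 2)`,
`TopologicalSpace.Opens`, `frontier`, `𝓝[>]`; it has no Lorentzian geometry, null expansions,
trapped surfaces or MOTS (`rg -i 'trapped|null expansion|marginally' Mathlib/Geometry` is empty).
Everything else comes from the H21 modules `Hypersurface` (`NormalField`, `IsNormalTo`,
`IsUnitNormal`, `normalDerivAlong`, `secondFundamentalForm`, `IsSpacelikeImmersion`,
`inducedMetric`, `inducedRiemannianMetric`, `meanCurvature`), `Isometry` (`pullbackBilin`),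
`Geodesic` (`curveThrough`), `LorentzianMetric` (`IsNull`, `TimeOrientation.IsFutureDirected`) and
`Volume` (`totalArea`).

## Design choices

* *Sign convention (h) of the outline.* `χ_L(v, w) := + g(D_v L, df w)` (same sign as
  `K_ν(v, w) = + g(D_v ν, df w)` in `Hypersurface.lean`), `θ_L := tr_{f^* g} χ_L`; on the data side
  `θ± := tr_S k ± H` with `k` taken w.r.t. the *future* unit normal of `X` and `H = tr K_ν` the
  mean curvature of `S ⊆ X` w.r.t. the *outward* unit normal `ν` (Andersson–Mars–Simon 2008,
  Def. 1: `θ± = p ± q` with `p = tr_S k`, `q = H`). For a round sphere in a time-symmetric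
  (`k = 0`) Euclidean slice `θ± = ± 2/r`, so it is untrapped, as it should be.
* `nullSecondFundamentalForm` *is* `secondFundamentalForm` applied to the null normal `L` (the
  honest-bilinearity device of `Hypersurface.lean` is inherited); `nullExpansion` is then the
  induced-metric trace, exactly parallel to `meanCurvature`.
* `IsTrappedSurface` follows the outline verbatim: compact, smoothly embedded, spacelike, admits a
  null normal pair, and *every* null normal pair has both expansions negative (the condition is
  invariant under the rescalings `(L, L̲) ↦ (a L, a⁻¹ L̲)`, `a > 0` a `C¹` function, and the swap
  `L ↔ L̲`, which exhaust the null normal pairs in codimension two; null normal pairs are required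
  to be `C¹`, otherwise the covariant derivatives in `θ_L` would be junk values and the `∀` would
  make the predicate vacuous). Codimension two (`dim S + 2 = dim M`) is the intended use and is
  implied by the existence of a null normal pair only up to `≥`; it is not imposed as a separate
  conjunct. On the data side no regularity of the unit normal `ν` is imposed: a unit normal of an
  embedded hypersurface pointing into a prescribed side is unique, hence as smooth as `df`.
* *`OutermostMOTS` is a hypothesis structure* bundling its own surface type `surf : Type`
  (with its seven instances as fields, made instances by `attribute [instance]`), the embedding,
  the outward normal, the open exterior region it bounds, the MOTS condition and the
  "outermost" condition: *no weakly outer trapped closed embedded surface lies inside the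
  exterior and encloses the MOTS* (Andersson–Mars–Simon 2008, §5; the enclosed side is recorded
  by an open `Ω'` with `frontier Ω' = range f'` into which the normal points and with
  `closure (exterior \ Ω')` compact — without this orientation datum every small round sphere,
  taken with its inward normal, would be weakly outer trapped and the structure would be
  uninhabited). The condition quantifies over all surface types `S' : Type`, which puts
  `OutermostMOTS I h k` in `Type 1` (at least); this is acceptable for a hypothesis structure
  consumed only by statements (Penrose inequality, area bounds). With several ends inside
  `exterior`, "enclosing" is understood relative to all of them at once (the region between `S`
  and `S'` is compact).
* Model with corners arguments (`I''` of `S`) are explicit where not determined by the other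
  arguments, as in `Hypersurface.lean`; no global `FiniteDimensional ℝ (TangentSpace I x)`
  instance is introduced.
* **M5 migration.** As prescribed by `Hypersurface.lean`, everything built on
  `secondFundamentalForm`/`meanCurvature` carries the standing Levi-Civita hypothesis
  `[g.HasLeviCivita]` (resp. `[(ofRiemannian h).HasLeviCivita]`), and everything built on the
  induced metric carries the smoothness hypothesis `hpb : contMDiff_pullbackBilin I M I'' S n`
  (a named fact of `Isometry.lean`), threaded explicitly next to `hf`.  In `IsTrappedSurface`
  `hpb` is bound existentially together with `hf` (so the signature is unchanged); in the
  hypothesis structure `OutermostMOTS` both are fields (`hpb`, `[hasLeviCivita]`), so that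
  `OutermostMOTS I h k` keeps its signature for `MassInequalities`.  `surfaceArea_lt_top` is
  proved from the named fact `riemannianVolume_lt_top_of_isCompact` of `Volume.lean`, taken as a
  hypothesis.

## References

* R. Penrose, *Gravitational collapse and space-time singularities*, Phys. Rev. Lett. 14 (1965)
  57–59 (trapped surfaces).
* S. W. Hawking, G. F. R. Ellis, *The large scale structure of space-time*, CUP 1973, §4.2
  (null second fundamental forms `χ`), §9.2 (trapped and marginally trapped surfaces, apparent
  horizon).
* L. Andersson, M. Mars, W. Simon, *Stability of marginally outer trapped surfaces and existence
  of marginally outer trapped tubes*, Adv. Theor. Math. Phys. 12 (2008) 853–888, Def. 1–2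
  (`θ± = p ± q`, MOTS, weakly outer trapped, outermost MOTS).
* R. M. Wald, *General Relativity*, Chicago 1984, §9.5 and §12.2 (trapped surfaces, apparent
  horizons `θ₊ = 0`).
-/

noncomputable section

open Bundle Set Manifold TopologicalSpace Filter
open scoped ContDiff Topology ENNReal

namespace Literature.Geometry.Lorentzian

variable {E : Type*} [NormedAddCommGroup E] [NormedSpace ℝ E] {H : Type*} [TopologicalSpace H]
  {I : ModelWithCorners ℝ E H} {M : Type*} [TopologicalSpace M] [ChartedSpace H M]
  {E'' : Type*} [NormedAddCommGroup E''] [NormedSpace ℝ E''] {H'' : Type*} [TopologicalSpace H'']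
  {I'' : ModelWithCorners ℝ E'' H''} {S : Type*} [TopologicalSpace S] [ChartedSpace H'' S]
  [IsManifold I ∞ M] {n : ℕ∞ω}

/-! ### Spacetime side: null normal pairs, null expansions, trapped surfaces -/

namespace LorentzianMetric

variable (I'') in
/-- A *null normal pair* `(L, L̲)` of the map `f : S → M` (meant: a spacelike immersion of
codimension two) in the time-oriented Lorentzian manifold `(M, g, τ)`: two vector fields along
`f`, both normal to `f`, null and future-directed at every point, normalised by
`g(L, L̲) = -2`, and `C¹` as maps into `TM` (so that their null expansions are honest
derivatives; in codimension two the remaining freedom is `(L, L̲) ↦ (a L, a⁻¹ L̲)` with `a > 0` a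
`C¹` function, and the swap). Hawking–Ellis 1973, §4.2 and §9.2; Andersson–Mars–Simon 2008, §2
(`l^±`). [cite: HawkingEllis1973, §4.2 and §9.2] -/
structure NullNormalPair (g : LorentzianMetric I n M) (τ : TimeOrientation g) (f : S → M) where
  /-- The (outgoing) null normal `L`. -/
  L : NormalField I f
  /-- The (ingoing) null normal `L̲`. -/
  Lbar : NormalField I f
  /-- `L` is normal to `f`. -/
  isNormalTo_L : g.IsNormalTo I'' f L
  /-- `L̲` is normal to `f`. -/
  isNormalTo_Lbar : g.IsNormalTo I'' f Lbar
  /-- `L` is null. -/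
  isNull_L (y : S) : g.IsNull (L y)
  /-- `L̲` is null. -/
  isNull_Lbar (y : S) : g.IsNull (Lbar y)
  /-- `L` is future-directed. -/
  isFutureDirected_L (y : S) : τ.IsFutureDirected (L y)
  /-- `L̲` is future-directed. -/
  isFutureDirected_Lbar (y : S) : τ.IsFutureDirected (Lbar y)
  /-- Normalisation `g(L, L̲) = -2`. -/
  val_L_Lbar (y : S) : g.val (f y) (L y) (Lbar y) = -2
  /-- `L` is a `C¹` field along `f` (as a map `S → TM`). -/
  contMDiff_L :
    ContMDiff I'' I.tangent 1 (fun y ↦ (TotalSpace.mk' E (f y) (L y) : TangentBundle I M))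
  /-- `L̲` is a `C¹` field along `f` (as a map `S → TM`). -/
  contMDiff_Lbar :
    ContMDiff I'' I.tangent 1 (fun y ↦ (TotalSpace.mk' E (f y) (Lbar y) : TangentBundle I M))

namespace NullNormalPair

variable {g : LorentzianMetric I n M} {τ : TimeOrientation g} {f : S → M}

/-- The *swapped* null normal pair `(L̲, L)`. Hawking–Ellis 1973, §9.2. [cite: HawkingEllis1973, §9.2] -/
def swap (P : NullNormalPair I'' g τ f) : NullNormalPair I'' g τ f where
  L := P.Lbar
  Lbar := P.L
  isNormalTo_L := P.isNormalTo_Lbar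
  isNormalTo_Lbar := P.isNormalTo_L
  isNull_L := P.isNull_Lbar
  isNull_Lbar := P.isNull_L
  isFutureDirected_L := P.isFutureDirected_Lbar
  isFutureDirected_Lbar := P.isFutureDirected_L
  val_L_Lbar y := by rw [g.symm]; exact P.val_L_Lbar y
  contMDiff_L := P.contMDiff_Lbar
  contMDiff_Lbar := P.contMDiff_L

/-- Swapping twice gives back the original pair. [folklore] -/
@[simp]
lemma swap_swap (P : NullNormalPair I'' g τ f) : P.swap.swap = P := rfl

end NullNormalPair

section NullExpansion

variable [FiniteDimensional ℝ E] [CompleteSpace E] [Fact (1 ≤ n)] [FiniteDimensional ℝ E'']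
  (g : LorentzianMetric I n M) [g.HasLeviCivita] (f : S → M)

variable (I'') in
/-- The *null second fundamental form* `χ_L` of `f : S → M` with respect to the field `L`
along `f` (meant: a null normal), the bilinear form on `T_y S` with
`χ_L(v, w) = + g_{f y}(D_v L, df_y w)` (sign convention (h); this is `secondFundamentalForm`
of `Hypersurface.lean` for the field `L`). Hawking–Ellis 1973, §4.2 (`χ_{ab}`); Wald 1984,
(9.5.1) ff.; Andersson–Mars–Simon 2008, §2. [cite: HawkingEllis1973, §4.2 ( χ_{ab}] -/
def nullSecondFundamentalForm (L : NormalField I f) (y : S) :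
    LinearMap.BilinForm ℝ (TangentSpace I'' y) :=
  g.secondFundamentalForm I'' f L y

omit [CompleteSpace E] [Fact (1 ≤ n)] in
/-- Unfolding lemma: `χ_L = K_L`. [folklore] -/
lemma nullSecondFundamentalForm_eq (L : NormalField I f) (y : S) :
    g.nullSecondFundamentalForm I'' f L y = g.secondFundamentalForm I'' f L y :=
  rfl

variable [IsManifold I'' ∞ S]

/-- The *null expansion* `θ_L(y) = tr_{f^* g} χ_L = (f^* g)^{AB} (χ_L)_{AB}` of the spacelike
immersion `f : S → M` with respect to the field `L` along `f` (meant: a null normal): the trace of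
the null second fundamental form w.r.t. the induced Riemannian metric (hypothesis `hpb`: smoothness
of pullbacks, as for `inducedMetric`). Hawking–Ellis 1973, §4.2 and §9.2 (`θ = χ^a{}_a`);
Andersson–Mars–Simon 2008, §2 (`θ^±`); Penrose 1965. [cite: HawkingEllis1973, §4.2 and §9.2 ( θ = χ^a{}_a] -/
def nullExpansion (hpb : PseudoRiemannianMetric.contMDiff_pullbackBilin I M I'' S n)
    (hf : g.IsSpacelikeImmersion I'' f) (L : NormalField I f) (y : S) : ℝ :=
  (g.inducedMetric f hpb hf).trace y (g.nullSecondFundamentalForm I'' f L y)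

omit [CompleteSpace E] [Fact (1 ≤ n)] in
/-- The null expansion is the mean curvature `tr K_L` of `Hypersurface.lean` for the field `L`
(by definition). [folklore] -/
lemma nullExpansion_eq_meanCurvature (hpb : PseudoRiemannianMetric.contMDiff_pullbackBilin I M I'' S n)
    (hf : g.IsSpacelikeImmersion I'' f) (L : NormalField I f)
    (y : S) : g.nullExpansion f hpb hf L y = g.meanCurvature f hpb hf L y :=
  rfl

end NullExpansion

section Trapped

variable [FiniteDimensional ℝ E] [CompleteSpace E] [Fact (1 ≤ n)] [FiniteDimensional ℝ E'']
  [IsManifold I'' ∞ S] (g : LorentzianMetric I n M) [g.HasLeviCivita] {f : S → M}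

variable (I'') in
/-- **gr.S18** (trapped surface; Penrose 1965; Hawking–Ellis §9.2; Andersson–Mars–Simon, ATMP 12
(2008) Def. 1–2). The map `f : S → M` is a (closed) *trapped surface* of the time-oriented
Lorentzian manifold `(M, g, τ)`: `S` is compact, `f` is a smooth embedding and a spacelike
immersion, `f` admits a null normal pair, and for *every* null normal pair `(L, L̲)` both null
expansions are negative everywhere, `θ_L < 0` and `θ_L̲ < 0` (Penrose 1965: "both families of
null geodesics orthogonal to `S` converge"). Intended for `dim S + 2 = dim M`. The smoothness
fact `hpb` needed to form the induced metric is bound together with `hf`. [cite: Penrose1965, "both families of null geodesics orthogo] -/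
def IsTrappedSurface (τ : TimeOrientation g) (f : S → M) : Prop :=
  CompactSpace S ∧ Manifold.IsSmoothEmbedding I'' I ∞ f ∧
    ∃ (hpb : PseudoRiemannianMetric.contMDiff_pullbackBilin I M I'' S n)
      (hf : g.IsSpacelikeImmersion I'' f), Nonempty (NullNormalPair I'' g τ f) ∧
      ∀ P : NullNormalPair I'' g τ f, ∀ y : S,
        g.nullExpansion f hpb hf P.L y < 0 ∧ g.nullExpansion f hpb hf P.Lbar y < 0

variable {g}

/-- The map `f` is a *marginally outer trapped surface (MOTS)* with respect to the null normal
pair `P = (L, L̲)` (with `L` the *outer* null normal): the outer null expansion vanishes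
identically, `θ_L = 0`. Andersson–Mars–Simon 2008, Def. 2; Hawking–Ellis 1973, §9.2 (marginally
trapped, apparent horizon); Wald 1984, §12.2. [cite: AnderssonMarsSimon2008, Def. 2] -/
def IsMarginallyOuterTrapped {τ : TimeOrientation g}
    (hpb : PseudoRiemannianMetric.contMDiff_pullbackBilin I M I'' S n)
    (hf : g.IsSpacelikeImmersion I'' f) (P : NullNormalPair I'' g τ f) : Prop :=
  ∀ y : S, g.nullExpansion f hpb hf P.L y = 0

/-- The map `f` is a *marginally trapped surface* with respect to the null normal pair
`P = (L, L̲)`: `θ_L = 0` and `θ_L̲ < 0` everywhere. Hawking–Ellis 1973, §9.2; Andersson–Mars–Simon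
2008, §2. [cite: HawkingEllis1973, §9.2] -/
def IsMarginallyTrapped {τ : TimeOrientation g}
    (hpb : PseudoRiemannianMetric.contMDiff_pullbackBilin I M I'' S n)
    (hf : g.IsSpacelikeImmersion I'' f) (P : NullNormalPair I'' g τ f) : Prop :=
  ∀ y : S, g.nullExpansion f hpb hf P.L y = 0 ∧ g.nullExpansion f hpb hf P.Lbar y < 0

omit [CompleteSpace E] [Fact (1 ≤ n)] in
/-- A marginally trapped surface is marginally outer trapped. [folklore] -/
lemma IsMarginallyTrapped.isMarginallyOuterTrapped {τ : TimeOrientation g}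
    {hpb : PseudoRiemannianMetric.contMDiff_pullbackBilin I M I'' S n}
    {hf : g.IsSpacelikeImmersion I'' f} {P : NullNormalPair I'' g τ f}
    (h : g.IsMarginallyTrapped hpb hf P) : g.IsMarginallyOuterTrapped hpb hf P :=
  fun y ↦ (h y).1

end Trapped

end LorentzianMetric

/-! ### Data side: `θ± = tr_S k ± H`, MOTS, weakly outer trapped surfaces -/

section Data

variable [FiniteDimensional ℝ E] [CompleteSpace E] [Fact (1 ≤ n)] [FiniteDimensional ℝ E'']
  [IsManifold I'' ∞ S]
  (h : ContMDiffRiemannianMetric I n E (TangentSpace I : M → Type _))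
  (k : Π x : M, TangentSpace I x →L[ℝ] TangentSpace I x →L[ℝ] ℝ) (f : S → M)

open PseudoRiemannianMetric

omit [CompleteSpace E] [Fact (1 ≤ n)] in
/-- The *surface trace* `tr_S k (y) = (f^* h)^{AB} (f^* k)_{AB}` of the symmetric tensor `k` of a
data set `(X, h, k)` over the spacelike immersed surface `f : S → X`: the trace of the pulled-back
form `f^* k` with respect to the induced metric `f^* h`. Andersson–Mars–Simon 2008, §2 (the
quantity `p = γ^{AB} K_{AB}`); hypothesis `hpb` as for `inducedMetric`. [cite: AnderssonMarsSimon2008, §2 (the quantity  p = γ^{AB} K_{AB}] -/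
def traceKOnSurface (hpb : contMDiff_pullbackBilin I M I'' S n)
    (hf : (ofRiemannian h).IsSpacelikeImmersion I'' f) (y : S) : ℝ :=
  ((ofRiemannian h).inducedMetric f hpb hf).trace y
    (pullbackBilin (I := I) (I' := I'') f k y).toLinearMap₁₂

variable [(ofRiemannian h).HasLeviCivita]

/-- The *outer null expansion in the data*, `θ⁺(y) = tr_S k (y) + H(y)`, of the surface
`f : S → X` in the data set `(X, h, k)` with respect to the unit normal `ν` (meant: the *outward*
unit normal), where `H = tr K_ν` is the mean curvature of `f` in `(X, h)` (sign convention (h):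
`K_ν(v, w) = + h(D_v ν, df w)`) and `k` is the second fundamental form of `X` in spacetime w.r.t.
the future unit normal `n`; this is the expansion along the outer future null normal
`l⁺ = n + ν`. Andersson–Mars–Simon, ATMP 12 (2008), Def. 1 (`θ⁺ = p + q`). [folklore] -/
def outerNullExpansionInData (hpb : contMDiff_pullbackBilin I M I'' S n)
    (hf : (ofRiemannian h).IsSpacelikeImmersion I'' f) (ν : NormalField I f) (y : S) : ℝ :=
  traceKOnSurface h k f hpb hf y + (ofRiemannian h).meanCurvature f hpb hf ν y

/-- The *inner null expansion in the data*, `θ⁻(y) = tr_S k (y) - H(y)`, the expansion along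
the inner future null normal `l⁻ = n - ν` (conventions as in `outerNullExpansionInData`).
Andersson–Mars–Simon, ATMP 12 (2008), Def. 1 (`θ⁻ = p - q`). [folklore] -/
def innerNullExpansionInData (hpb : contMDiff_pullbackBilin I M I'' S n)
    (hf : (ofRiemannian h).IsSpacelikeImmersion I'' f) (ν : NormalField I f) (y : S) : ℝ :=
  traceKOnSurface h k f hpb hf y - (ofRiemannian h).meanCurvature f hpb hf ν y

omit [CompleteSpace E] [Fact (1 ≤ n)] in
/-- `θ⁺ + θ⁻ = 2 tr_S k`. Andersson–Mars–Simon 2008, Def. 1. [cite: AnderssonMarsSimon2008, Def. 1] -/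
lemma outerNullExpansionInData_add_inner (hpb : contMDiff_pullbackBilin I M I'' S n)
    (hf : (ofRiemannian h).IsSpacelikeImmersion I'' f)
    (ν : NormalField I f) (y : S) :
    outerNullExpansionInData h k f hpb hf ν y + innerNullExpansionInData h k f hpb hf ν y =
      2 * traceKOnSurface h k f hpb hf y := by
  simp only [outerNullExpansionInData, innerNullExpansionInData]
  ring

omit [CompleteSpace E] [Fact (1 ≤ n)] in
/-- `θ⁺ - θ⁻ = 2 H`. Andersson–Mars–Simon 2008, Def. 1. [cite: AnderssonMarsSimon2008, Def. 1] -/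
lemma outerNullExpansionInData_sub_inner (hpb : contMDiff_pullbackBilin I M I'' S n)
    (hf : (ofRiemannian h).IsSpacelikeImmersion I'' f)
    (ν : NormalField I f) (y : S) :
    outerNullExpansionInData h k f hpb hf ν y - innerNullExpansionInData h k f hpb hf ν y =
      2 * (ofRiemannian h).meanCurvature f hpb hf ν y := by
  simp only [outerNullExpansionInData, innerNullExpansionInData]
  ring

omit [CompleteSpace E] [Fact (1 ≤ n)] in
/-- In *time-symmetric data* (`k = 0`) the outer null expansion is the mean curvature,
`θ⁺ = H`. Andersson–Mars–Simon 2008, §2; Huisken–Ilmanen 2001, §1. [cite: AnderssonMarsSimon2008, §2] -/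
lemma outerNullExpansionInData_zero (hpb : contMDiff_pullbackBilin I M I'' S n)
    (hf : (ofRiemannian h).IsSpacelikeImmersion I'' f)
    (ν : NormalField I f) (y : S) :
    outerNullExpansionInData h 0 f hpb hf ν y = (ofRiemannian h).meanCurvature f hpb hf ν y := by
  have h0 : (pullbackBilin (I := I) (I' := I'') f
      (0 : Π x : M, TangentSpace I x →L[ℝ] TangentSpace I x →L[ℝ] ℝ) y).toLinearMap₁₂ = 0 := by
    ext v w
    simp [pullbackBilin]
  simp [outerNullExpansionInData, traceKOnSurface, h0, PseudoRiemannianMetric.trace]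

/-- The surface `f : S → X` with unit normal `ν` is a *marginally outer trapped surface (MOTS)
in the data set `(X, h, k)`*: `θ⁺ = tr_S k + H = 0` everywhere. Andersson–Mars–Simon, ATMP 12
(2008), Def. 2. [folklore] -/
def IsMOTSInData (hpb : contMDiff_pullbackBilin I M I'' S n)
    (hf : (ofRiemannian h).IsSpacelikeImmersion I'' f) (ν : NormalField I f) : Prop :=
  ∀ y : S, outerNullExpansionInData h k f hpb hf ν y = 0

/-- The surface `f : S → X` with unit normal `ν` is *weakly outer trapped* in the data set
`(X, h, k)`: `θ⁺ = tr_S k + H ≤ 0` everywhere. Andersson–Mars–Simon, ATMP 12 (2008), Def. 2. [folklore] -/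
def IsWeaklyOuterTrapped (hpb : contMDiff_pullbackBilin I M I'' S n)
    (hf : (ofRiemannian h).IsSpacelikeImmersion I'' f) (ν : NormalField I f) : Prop :=
  ∀ y : S, outerNullExpansionInData h k f hpb hf ν y ≤ 0

variable {h k f} in
omit [CompleteSpace E] [Fact (1 ≤ n)] in
/-- A MOTS is weakly outer trapped. Andersson–Mars–Simon 2008, Def. 2. [cite: AnderssonMarsSimon2008, Def. 2] -/
lemma IsMOTSInData.isWeaklyOuterTrapped {hpb : contMDiff_pullbackBilin I M I'' S n}
    {hf : (ofRiemannian h).IsSpacelikeImmersion I'' f}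
    {ν : NormalField I f} (hS : IsMOTSInData h k f hpb hf ν) : IsWeaklyOuterTrapped h k f hpb hf ν :=
  fun y ↦ (hS y).le

omit [CompleteSpace E] [Fact (1 ≤ n)] in
/-- In time-symmetric data (`k = 0`), a surface is a MOTS iff it is a maximal (i.e. minimal,
`H = 0`) slice of `(X, h)`. Huisken–Ilmanen 2001, §1; Andersson–Mars–Simon 2008, §2. [cite: HuiskenIlmanen2001, §1] -/
lemma isMOTSInData_zero_iff (hpb : contMDiff_pullbackBilin I M I'' S n)
    (hf : (ofRiemannian h).IsSpacelikeImmersion I'' f)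
    (ν : NormalField I f) :
    IsMOTSInData h 0 f hpb hf ν ↔ (ofRiemannian h).IsMaximalSlice f hpb hf ν := by
  simp only [IsMOTSInData, outerNullExpansionInData_zero]
  rfl

end Data

/-! ### Outermost MOTS (hypothesis structure) and its area -/

section Outermost

variable [FiniteDimensional ℝ E] [CompleteSpace E] [Fact (1 ≤ n)] {X : Type*} [TopologicalSpace X]
  [ChartedSpace H X] [IsManifold I ∞ X]

open PseudoRiemannianMetric

variable (I) in
/-- **gr.S18** (outermost MOTS / apparent horizon in a data set, and its area; Andersson–Mars–Simon,
ATMP 12 (2008) Def. 1–2 and §5; Hawking–Ellis §9.2). Hypothesis structure: an *outermost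
marginally outer trapped surface* in the data set `(X, h, k)`. It bundles

* its own surface type `surf` (a compact Hausdorff `2`-manifold without boundary modelled on
  `EuclideanSpace ℝ (Fin 2)`, with a Borel measurable structure for its area), smoothly and
  spacelikely embedded by `f : surf → X`, with a unit normal `ν`;
* the open *exterior region* `exterior ⊆ X` it bounds (`frontier exterior = range f`), into
  which `ν` points (`ν` is the *outward* normal: the chart-straight curves with velocity `ν y`
  enter `exterior` for small positive times);
* the smoothness fact `hpb` for pullbacks to `surf` and the Levi-Civita hypothesis
  `[hasLeviCivita : (ofRiemannian h).HasLeviCivita]` (M5 migration, see the module docstring);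
* the MOTS condition `θ⁺ = tr_S k + H = 0` (`IsMOTSInData`, conventions (h));
* the *outermost* condition: there is no compact embedded weakly outer trapped (`θ⁺ ≤ 0`)
  surface `f' : S' → X` lying strictly inside `exterior` and *enclosing* `S` — encoded by an open
  `Ω' ⊆ exterior` (the exterior of `S'`) with `frontier Ω' = range f'`, `ν'` the unit normal
  pointing into `Ω'`, and the closed region `closure (exterior \ Ω')` between `S` and `S'`
  compact (this orientation datum is essential: with the inward normal every small round sphere
  has `θ⁺ = -2/r ≤ 0`). The quantification over all surface types `S' : Type` puts
  `OutermostMOTS I h k` in `Type 1` (at least); this is acceptable for a hypothesis structure.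

Bracketed fields are made instances below; `T3Space surf` (needed for the length metric) follows
from compactness and `T2`. [folklore] -/
structure OutermostMOTS (h : ContMDiffRiemannianMetric I n E (TangentSpace I : X → Type _))
    (k : Π x : X, TangentSpace I x →L[ℝ] TangentSpace I x →L[ℝ] ℝ) where
  /-- The surface type. -/
  surf : Type
  /-- Topology of the surface. -/
  [top : TopologicalSpace surf]
  /-- The surface is a `2`-manifold. -/
  [charted : ChartedSpace (EuclideanSpace ℝ (Fin 2)) surf]
  /-- The surface is a smooth manifold. -/
  [mfd : IsManifold (𝓡 2) ∞ surf]
  /-- The surface is compact. -/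
  [compact : CompactSpace surf]
  /-- The surface is Hausdorff. -/
  [t2 : T2Space surf]
  /-- Measurable structure of the surface (for its area). -/
  [meas : MeasurableSpace surf]
  /-- The measurable structure is the Borel one. -/
  [borel : BorelSpace surf]
  /-- The standing Levi-Civita hypothesis of `(X, h)` (`Hypersurface.lean`, M5 migration). -/
  [hasLeviCivita : (ofRiemannian h).HasLeviCivita]
  /-- Smoothness of pullbacks of bilinear forms to `surf` (the named fact
  `contMDiff_pullbackBilin` of `Isometry.lean`). -/
  hpb : contMDiff_pullbackBilin I X (𝓡 2) surf n
  /-- The map of the surface into the data manifold. -/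
  f : surf → X
  /-- The outward unit normal along `f`. -/
  ν : NormalField I f
  /-- `f` is a spacelike immersion into `(X, h)`. -/
  isSpacelikeImmersion : (ofRiemannian h).IsSpacelikeImmersion (𝓡 2) f
  /-- `f` is a smooth embedding. -/
  isEmbedding : Manifold.IsSmoothEmbedding (𝓡 2) I ∞ f
  /-- `ν` is a unit normal (`h(ν, ν) = 1`, `ν ⊥ df`). -/
  isUnitNormal : (ofRiemannian h).IsUnitNormal (𝓡 2) f ν 1
  /-- The open exterior region bounded by the surface. -/
  exterior : Opens X
  /-- The surface is the boundary of the exterior region. -/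
  frontier_exterior : frontier (exterior : Set X) = range f
  /-- `ν` points into the exterior region: the chart-straight curve through `f y` with velocity
  `ν y` lies in `exterior` for small `t > 0`. -/
  pointsInto (y : surf) : ∀ᶠ t in 𝓝[>] (0 : ℝ), curveThrough I (f y) (ν y) t ∈ (exterior : Set X)
  /-- The surface is a MOTS: `θ⁺ = tr_S k + H = 0`. -/
  isMOTS : IsMOTSInData h k f hpb isSpacelikeImmersion ν
  /-- *Outermost*: no compact embedded surface strictly inside the exterior region and enclosing
  the MOTS is weakly outer trapped (`θ⁺ ≤ 0`) with respect to its outward unit normal. -/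
  no_weaklyOuterTrapped_in_exterior :
    ∀ (S' : Type) [TopologicalSpace S'] [ChartedSpace (EuclideanSpace ℝ (Fin 2)) S']
      [IsManifold (𝓡 2) ∞ S'] [CompactSpace S'] [T2Space S'] (f' : S' → X)
      (ν' : NormalField I f') (hpb' : contMDiff_pullbackBilin I X (𝓡 2) S' n)
      (hf' : (ofRiemannian h).IsSpacelikeImmersion (𝓡 2) f') (Ω' : Opens X),
      Manifold.IsSmoothEmbedding (𝓡 2) I ∞ f' → range f' ⊆ (exterior : Set X) →
      (Ω' : Set X) ⊆ (exterior : Set X) → frontier (Ω' : Set X) = range f' →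
      IsCompact (closure ((exterior : Set X) \ Ω')) →
      (∀ y, ∀ᶠ t in 𝓝[>] (0 : ℝ), curveThrough I (f' y) (ν' y) t ∈ (Ω' : Set X)) →
      (ofRiemannian h).IsUnitNormal (𝓡 2) f' ν' 1 →
      ¬ IsWeaklyOuterTrapped h k f' hpb' hf' ν'

namespace OutermostMOTS

attribute [instance] top charted mfd compact t2 meas borel

variable {h : ContMDiffRiemannianMetric I n E (TangentSpace I : X → Type _)}
  {k : Π x : X, TangentSpace I x →L[ℝ] TangentSpace I x →L[ℝ] ℝ}

omit [CompleteSpace E] [Fact (1 ≤ n)] in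
/-- An outermost MOTS is weakly outer trapped (the Levi-Civita instance argument may differ from
the bundled one only propositionally). Andersson–Mars–Simon 2008, Def. 2. [cite: AnderssonMarsSimon2008, Def. 2] -/
lemma isWeaklyOuterTrapped [(ofRiemannian h).HasLeviCivita] (S : OutermostMOTS I h k) :
    IsWeaklyOuterTrapped h k S.f S.hpb S.isSpacelikeImmersion S.ν :=
  S.isMOTS.isWeaklyOuterTrapped

omit [CompleteSpace E] [Fact (1 ≤ n)] in
/-- The image of an outermost MOTS is compact. [folklore] -/
lemma isCompact_range (S : OutermostMOTS I h k) : IsCompact (range S.f) :=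
  _root_.isCompact_range S.isEmbedding.isEmbedding.continuous

omit [CompleteSpace E] [Fact (1 ≤ n)] in
/-- The image of an outermost MOTS is disjoint from its (open) exterior region. [folklore] -/
lemma range_inter_exterior (S : OutermostMOTS I h k) :
    range S.f ∩ (S.exterior : Set X) = ∅ := by
  rw [← S.frontier_exterior, ← Set.disjoint_iff_inter_eq_empty]
  exact disjoint_frontier_iff_isOpen.mpr S.exterior.isOpen

/-- The *induced Riemannian metric* `f^* h` on an outermost MOTS. [folklore] -/
def inducedMetric (S : OutermostMOTS I h k) :
    ContMDiffRiemannianMetric (𝓡 2) n (EuclideanSpace ℝ (Fin 2))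
      (TangentSpace (𝓡 2) : S.surf → _) :=
  (ofRiemannian h).inducedRiemannianMetric S.f S.hpb S.isSpacelikeImmersion

/-- The *area* `|S| = ∫_S dA_{f^* h}` of an outermost MOTS: the total `2`-dimensional
(Euclidean-normalised Hausdorff) Riemannian volume of `surf` for the induced metric `f^* h`
(`totalArea` of `Volume.lean`); the quantity in the Penrose inequality `m ≥ √(|S|/16π)`.
Andersson–Mars–Simon 2008, §5; Hawking–Ellis 1973, §9.2; Bray 2001, Huisken–Ilmanen 2001. [cite: AnderssonMarsSimon2008, §5] -/
def surfaceArea (S : OutermostMOTS I h k) : ℝ≥0∞ :=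
  totalArea S.inducedMetric

omit [CompleteSpace E] [Fact (1 ≤ n)] in
/-- The area of an outermost MOTS is finite (the surface is compact): from the named fact
`riemannianVolume_lt_top_of_isCompact` of `Volume.lean` (compact sets have finite Riemannian
volume in every dimension `d ≥ dim`), here `d = 2 = dim surf`, `K = univ`.
Federer 1969, §3.2.46. [cite: Federer1969, §3.2.46] -/
theorem surfaceArea_lt_top (S : OutermostMOTS I h k)
    (hV : riemannianVolume_lt_top_of_isCompact (I := 𝓡 2) (n := n) (N := S.surf)) :
    S.surfaceArea < ⊤ :=
  hV S.inducedMetric (by simp) isCompact_univ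

end OutermostMOTS

end Outermost

end Literature.Geometry.Lorentzian

end
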